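import Summits.BirchSwinnertonDyer.BirchSwinnertonDyer.Theorems.ThetaPartnerAtTwoSignedKatoUpToAtTwoKummerEquivariant
import HarnessLib

/-!
# Route `ThetaPartnerAtTwo` (TP2), crux K3 `SignedKatoDivisibilityUpToAtTwo` (item stmt-BirchSwinnertonDyer-20308),
# line `colemanrat` v3 — THE POINTS-MODEL `j` AT `p = 2`, ASSEMBLED: on K3's habitat (`W/ℚ` globally minimal, `GoodSS W 2`,
# cyclotomic `κ`, any generator `γ`, any pinned `D`) there is an additive `j : Hom(⨆ₙ E^ε(ℚ_{2,n}·ℚ_v), ℤ₂) → X^ε` with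
# (value) the Kummer-witness formula, (vanishing) on `Sel^ε ∩ ker res_𝔭`, and (T-action) `T • j φ = j(φ ∘ σ) − j φ` for a local
# lift `σ` of `γ` — i.e. the map `j : P → X⁺` of the promoted package, `Λ`-linear in generator form, with NO hypothesis left.

Width seat `bsd-wall-tp2-p2x-w3` g2 (cell `bsd-wall`). HONEST FRAMING: THEOREMS ONLY — no definition, no named fact, no instance,
no `sorry`; closes no item; BSD is NOT proved by any of this.

## What is proved
* §1 `smul_mem_iSup_signedLocalPoints` — `A^ε = ⨆ₙ E^ε(K_n·K_v)` is `Γ_{K_v}`-stable (any `K`, `p`, `κ`, `ε`).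
* §2 `pointsModelJ_X_smul` — the `T`-action identity of `…KummerEquivariant` as an equality in `D.X` (ℚ, cyclotomic `κ`).
* §3 `exists_pointsModelJ_two_full` — `p = 2`: ∃ local lift `σ` of `γ` and ∃ `j` with (value) ∧ (vanishing on `ker res_𝔭`) ∧ (T-action).

References: [Kobayashi2003] Def. 1.1, (7.17), (8.23), Prop. 8.12 i); [Sprung2012] Def. 3.1/5.9, Lemma 2.3; [Washington1997] §13.1.
-/

set_option autoImplicit false
-- the Theorems namespace of this sub repeats the summit name by design (D-0017 nested layout)
set_option linter.dupNamespace false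

noncomputable section

open scoped Classical

namespace Summit.BirchSwinnertonDyer.BirchSwinnertonDyer.Theorems

namespace SignedKatoOffTwo.KummerPoint

open NumberField IsDedekindDomain Field WeierstrassCurve
  Literature.NumberTheory.EllipticCurves Literature.NumberTheory.EllipticCurves.Kobayashi2003
  Literature.NumberTheory.EllipticCurves.GreenbergSelmer Literature.NumberTheory.EllipticCurves.Rank1Residual
  Literature.NumberTheory.EllipticCurves.Sprung2012 Literature.NumberTheory.GaloisRepresentations ZpExtension
  Summit.BirchSwinnertonDyer.Rank1Residual.Additive

universe u

/-! ## §1 `⨆ₙ E^ε(K_n·K_v)` is `Γ_{K_v}`-stable -/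

section Stable

variable {K : Type u} [Field K] (W : WeierstrassCurve K) {p : ℕ} [Fact p.Prime] (κ : ZpExtension K p)
  {E : Type u} [Field E] [Algebra K E] (ι : AlgebraicClosure K →ₐ[K] AlgebraicClosure E)

/-- **`A^ε = ⨆ₙ E^ε(K_n·K_v)` is stable under `Γ_{K_v}`** (each `E^ε_n` is: the tower is normal and traces commute with the
Galois action; tree `smul_mem_towerSignedLocalPointsOfEmb`). [cite: Kobayashi2003, Prop. 8.12 i) (p. 17)] -/
theorem smul_mem_iSup_signedLocalPoints (ε : ℤˣ) (σ : Field.absoluteGaloisGroup E) {a : localPoints W E}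
    (ha : a ∈ ⨆ n, signedLocalPointsOfEmb κ ι W ε n) : σ • a ∈ ⨆ n, signedLocalPointsOfEmb κ ι W ε n := by
  refine AddSubgroup.iSup_induction (fun n ↦ signedLocalPointsOfEmb κ ι W ε n)
    (C := fun a ↦ σ • a ∈ ⨆ n, signedLocalPointsOfEmb κ ι W ε n) ha ?_ ?_ ?_
  · intro n a ha
    refine le_iSup (fun n ↦ signedLocalPointsOfEmb κ ι W ε n) n ?_
    rw [signedLocalPointsOfEmb_eq_towerSigned] at ha ⊢
    exact smul_mem_towerSignedLocalPointsOfEmb κ.layerSubgroup _ W ε n σ ha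
  · rw [smul_zero]; exact AddSubgroup.zero_mem _
  · intro a b ha hb; rw [smul_add]; exact AddSubgroup.add_mem _ ha hb

end Stable

/-! ## §2 The `T`-action as an identity in `X^ε` -/

section Rat

variable (W : WeierstrassCurve ℚ) {p : ℕ} [Fact p.Prime] (κ : ZpExtension ℚ p) {γ : absoluteGaloisGroup ℚ} (ε : ℤˣ)

/-- **`T • j φ_A = j (φ_A ∘ σ|_A) − j φ_A` in `X^ε`** (ℚ, cyclotomic `κ`, `σ` a local lift of `γ`): the `Λ`-linearity of the points-model
`j` in generator form, from `toDual_X_smul_pointsModelJ` and injectivity of `D.toDual`. [cite: Sprung2012, Def. 3.1 and Def. 5.9]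
[cite: Kobayashi2003, §8.5 (p. 18)] -/
theorem pointsModelJ_X_smul (v : HeightOneSpectrum (𝓞 ℚ)) (hv : (p : 𝓞 ℚ) ∈ v.asIdeal)
    (σ : absoluteGaloisGroup (v.adicCompletion ℚ)) (hσ : κ γ = κ (resGalOfEmb (closureEmb (K := ℚ) (v.adicCompletion ℚ)) σ))
    (D : SignedSelmerDualData W κ γ ε)
    (j : (↥(⨆ n, signedLocalPoints κ (v.adicCompletion ℚ) W ε n) →+ ℤ_[p]) →+ D.X)
    (hj : ∀ (φA : ↥(⨆ n, signedLocalPoints κ (v.adicCompletion ℚ) W ε n) →+ ℤ_[p])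
        (s : W.subgroupH1 p κ.kerSubgroup) (hs : s ∈ signedSelmerInfty W κ ε)
        (φ : contOneCocycles (discreteTopRep κ.kerSubgroup (W.geomPrimaryTorsion p)))
        (Q : localPoints W (v.adicCompletion ℚ)) (k : ℕ)
        (_ : oneCocycleClass _ φ = s) (hQ : p ^ k • Q ∈ (⨆ n, signedLocalPoints κ (v.adicCompletion ℚ) W ε n))
        (_ : ∀ τ : localSubgroupOfEmb κ.kerSubgroup (closureEmb (K := ℚ) (v.adicCompletion ℚ)),
          pointsMapOfEmb W (closureEmb (K := ℚ) (v.adicCompletion ℚ))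
              ((φ.1 (resGalSubgroupOfEmb κ.kerSubgroup _ τ) : W.geomPrimaryTorsion p) : W.geomPoints) =
            (τ : absoluteGaloisGroup (v.adicCompletion ℚ)) • Q - Q),
        D.toDual (j φA) ⟨s, hs⟩ =
          (PadicInt.toZModPow k (φA ⟨p ^ k • Q, hQ⟩)).val • ((((p : ℚ) ^ k)⁻¹ : ℚ) : AddCircle (1 : ℚ)))
    (φA : ↥(⨆ n, signedLocalPoints κ (v.adicCompletion ℚ) W ε n) →+ ℤ_[p]) :
    (PowerSeries.X : IwasawaAlgebra p) • j φA =
      j (φA.comp (((DistribSMul.toAddMonoidHom (localPoints W (v.adicCompletion ℚ)) σ).comp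
        (⨆ n, signedLocalPoints κ (v.adicCompletion ℚ) W ε n).subtype).codRestrict
          (⨆ n, signedLocalPoints κ (v.adicCompletion ℚ) W ε n)
          (fun a ↦ smul_mem_iSup_signedLocalPoints W κ _ ε σ a.2))) - j φA := by
  apply D.bijective.injective
  refine AddMonoidHom.ext fun s ↦ ?_
  rw [map_sub, AddMonoidHom.sub_apply]
  have h := toDual_X_smul_pointsModelJ W κ ε v hv σ hσ (fun a ha ↦ smul_mem_iSup_signedLocalPoints W κ _ ε σ ha) D j hj φA s s.2
  exact h

/-! ## §3 `p = 2`: everything assembled, no hypothesis left -/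

/-- **The points-model `j` of K3's package at `p = 2`, fully assembled**: `W/ℚ` globally minimal, `GoodSS W 2`, `κ` CYCLOTOMIC, any
`γ`, any sign, `v ∋ 2`, any pinned `D`. There are a local lift `σ ∈ Γ_{ℚ_v}` of `γ` and an additive
`j : Hom(⨆ₙ E^ε(ℚ_{2,n}·ℚ_v), ℤ₂) →+ D.X` with: (value) the Kummer-witness formula on `Sel^ε_∞`; (vanishing) `D.toDual (j φ) s = 0`
when `res_𝔭 s = 0`; (`T`-action) `T • j φ = j (φ ∘ σ) − j φ`. [cite: Kobayashi2003, (7.17), (8.23)] [cite: Sprung2012, Lemma 2.3, Def. 5.9]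
[cite: Washington1997, §13.1] -/
theorem exists_pointsModelJ_two_full [W.IsElliptic] [W.IsGloballyMinimal] (κ₂ : ZpExtension ℚ 2) (hκ : κ₂.IsCyclotomic)
    {γ₂ : absoluteGaloisGroup ℚ} (hss : GoodSS W 2) (v : HeightOneSpectrum (𝓞 ℚ)) (hv : (2 : 𝓞 ℚ) ∈ v.asIdeal)
    (D : SignedSelmerDualData W κ₂ γ₂ ε) :
    ∃ (σ : absoluteGaloisGroup (v.adicCompletion ℚ))
      (_ : κ₂ γ₂ = κ₂ (resGalOfEmb (closureEmb (K := ℚ) (v.adicCompletion ℚ)) σ))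
      (j : (↥(⨆ n, signedLocalPoints κ₂ (v.adicCompletion ℚ) W ε n) →+ ℤ_[2]) →+ D.X),
      (∀ (φA : ↥(⨆ n, signedLocalPoints κ₂ (v.adicCompletion ℚ) W ε n) →+ ℤ_[2])
        (s : W.subgroupH1 2 κ₂.kerSubgroup) (hs : s ∈ signedSelmerInfty W κ₂ ε)
        (φ : contOneCocycles (discreteTopRep κ₂.kerSubgroup (W.geomPrimaryTorsion 2)))
        (Q : localPoints W (v.adicCompletion ℚ)) (k : ℕ)
        (_ : oneCocycleClass _ φ = s) (hQ : 2 ^ k • Q ∈ (⨆ n, signedLocalPoints κ₂ (v.adicCompletion ℚ) W ε n))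
        (_ : ∀ τ : localSubgroupOfEmb κ₂.kerSubgroup (closureEmb (K := ℚ) (v.adicCompletion ℚ)),
          pointsMapOfEmb W (closureEmb (K := ℚ) (v.adicCompletion ℚ))
              ((φ.1 (resGalSubgroupOfEmb κ₂.kerSubgroup _ τ) : W.geomPrimaryTorsion 2) : W.geomPoints) =
            (τ : absoluteGaloisGroup (v.adicCompletion ℚ)) • Q - Q),
        D.toDual (j φA) ⟨s, hs⟩ =
          (PadicInt.toZModPow k (φA ⟨2 ^ k • Q, hQ⟩)).val • ((((2 : ℚ) ^ k)⁻¹ : ℚ) : AddCircle (1 : ℚ))) ∧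
      (∀ (φA : ↥(⨆ n, signedLocalPoints κ₂ (v.adicCompletion ℚ) W ε n) →+ ℤ_[2]) (s : W.subgroupH1 2 κ₂.kerSubgroup)
        (hs : s ∈ signedSelmerInfty W κ₂ ε),
        Literature.NumberTheory.EllipticCurves.resOfLe (W.geomPrimaryTorsion 2)
            (inf_le_left : κ₂.kerSubgroup ⊓ decomp v ≤ κ₂.kerSubgroup) s = 0 →
          D.toDual (j φA) ⟨s, hs⟩ = 0) ∧
      (∀ φA : ↥(⨆ n, signedLocalPoints κ₂ (v.adicCompletion ℚ) W ε n) →+ ℤ_[2],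
        (PowerSeries.X : IwasawaAlgebra 2) • j φA =
          j (φA.comp (((DistribSMul.toAddMonoidHom (localPoints W (v.adicCompletion ℚ)) σ).comp
            (⨆ n, signedLocalPoints κ₂ (v.adicCompletion ℚ) W ε n).subtype).codRestrict
              (⨆ n, signedLocalPoints κ₂ (v.adicCompletion ℚ) W ε n)
              (fun a ↦ smul_mem_iSup_signedLocalPoints W κ₂ _ ε σ a.2))) - j φA) := by
  have hv' : ((2 : ℕ) : 𝓞 ℚ) ∈ v.asIdeal := by exact_mod_cast hv
  obtain ⟨σ, hσ⟩ := hκ.exists_apply_resGalOfEmb_adicCompletion_eq v hv' (κ₂ γ₂)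
  obtain ⟨j, hj⟩ := exists_pointsModelJ_two W κ₂ ε hss v hv D
  exact ⟨σ, hσ.symm, j, hj, fun φA s hs hres ↦ toDual_pointsModelJ_eq_zero_of_resOfLe_eq_zero W 2 κ₂ ε v D j hj φA hs hres,
    fun φA ↦ pointsModelJ_X_smul W κ₂ ε v hv' σ hσ.symm D j hj φA⟩

end Rat

end SignedKatoOffTwo.KummerPoint

end Summit.BirchSwinnertonDyer.BirchSwinnertonDyer.Theorems

end
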